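import Literature.Geometry.Riemannian.LinearHeatWeakRegularity
import HarnessLib

/-!
# Heat hypoellipticity on a non-compact manifold: measure transfer to space-time charts
(crux `EntropyRung.NoncompactShrinkerGap`, stmt-SmoothPoincare4-10868, line `collapsed-ends-usc`, v13)

`LinearHeatWeakRegularity.lean` proves interior regularity of very weak solutions of the linear
heat equation on a CLOSED manifold; its measure-transfer lemmas
(`ae_source_of_ae_target`, `ae_prod_chart_of_ae_volume`, `locallyIntegrableOn_comp_chart_prod`)
carry `[CompactSpace M]` only to synthesise `T3Space M` (needed to state `riemannianMeasure`)
and, in the last one, to get `SFinite (riemannianMeasure G₀)` for Tonelli. Here the three lemmas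
are re-proved verbatim for a manifold that is merely `T3` and second countable: the Riemannian
measure is finite on compact sets (`riemannianVolume_lt_top_of_isCompact_holds`), the manifold is
locally compact (`Manifold.locallyCompact_of_finiteDimensional`), hence the measure is locally
finite and σ-finite.

* `ae_prod_chart_of_ae_volume_nc` — Lebesgue-null sets of the space-time chart pull back to
  `dV_{g₀} ⊗ ds`-null sets of the chart domain (stated for the measure `g₀.riemVolume` of a
  Riemannian `g₀`, the form in which the regularity theorem consumes it);
* `locallyIntegrableOn_comp_chart_prod_nc` — local integrability on `M × T` for `dV_{g₀} ⊗ ds`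
  passes to the space-time chart `φ.target × T`.

## References

* I. Chavel, *Riemannian Geometry: A Modern Introduction*, 2nd ed., CUP 2006, §III.3 (III.3.5),
  (III.3.6). [Chavel2006]
* H. Federer, *Geometric Measure Theory*, Springer 1969, §3.2.46. [Federer1969]
-/

noncomputable section

set_option linter.dupNamespace false

open Bundle Set Function Filter MeasureTheory Measure TopologicalSpace
open scoped Manifold ContDiff Topology Matrix ENNReal
open Literature.Geometry.Riemannian Literature.Geometry.Lorentzian
  Literature.Geometry.Lorentzian.PseudoRiemannianMetric

namespace Summit.SmoothPoincare4.SmoothPoincare4.Theorems.NoncompactShrinkerGapHeat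

variable {m : ℕ} {H : Type*} [TopologicalSpace H]
  {I : ModelWithCorners ℝ (EuclideanSpace ℝ (Fin m)) H}
  {M : Type*} [TopologicalSpace M] [ChartedSpace H M]
  [IsManifold I ∞ M] [T3Space M] [MeasurableSpace M] [BorelSpace M]
  {g₀ : PseudoRiemannianMetric I ∞ (EuclideanSpace ℝ (Fin m)) (TangentSpace I : M → Type _)}

/-- Null sets transfer from the chart target to the chart domain
(`φ_*(μ_h|source) = √g · vol|target ≪ vol`); non-compact `M`. [folklore] -/
private theorem ae_source_of_ae_target_nc
    (G₀ : ContMDiffRiemannianMetric I ∞ (EuclideanSpace ℝ (Fin m)) (TangentSpace I : M → Type _)) (x : M)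
    {P : EuclideanSpace ℝ (Fin m) → Prop}
    (hae : ∀ᵐ y ∂(volume : Measure (EuclideanSpace ℝ (Fin m))), P y) :
    ∀ᵐ p ∂riemannianMeasure G₀, p ∈ (extChartAt I x).source → P (extChartAt I x p) := by
  -- adapted from `Literature.Geometry.Riemannian.ae_source_of_ae_target`
  have hs : MeasurableSet (extChartAt I x).source := (isOpen_extChartAt_source x).measurableSet
  have h1 : ∀ᵐ y ∂((volume : Measure (EuclideanSpace ℝ (Fin m))).restrict
      (extChartAt I x).target), P y := ae_restrict_of_ae hae
  have h2 : ∀ᵐ y ∂(((volume : Measure (EuclideanSpace ℝ (Fin m))).restrict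
      (extChartAt I x).target).withDensity
        (fun y ↦ ENNReal.ofReal (Real.sqrt (chartGramMatrix G₀ x y).det))), P y :=
    (withDensity_absolutelyContinuous _ _).ae_le h1
  rw [← map_extChartAt_restrict_riemannianMeasure G₀ x] at h2
  have h3 := ae_of_ae_map (aemeasurable_extChartAt_restrict x (riemannianMeasure G₀)) h2
  rw [ae_restrict_iff' hs] at h3
  exact h3

/-- **Null sets transfer from the space-time chart to `M × ℝ`** (non-compact `M`): a property
holding Lebesgue-a.e. on `ℝᵐ × ℝ` holds `(dV_{g₀} ⊗ ds)`-a.e. at `(φ p.1, p.2)` for `p.1` in the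
chart domain (`g₀` Riemannian, `dV_{g₀} = g₀.riemVolume`). [folklore] -/
theorem ae_prod_chart_of_ae_volume_nc (hR₀ : g₀.IsRiemannian) (x : M) {P : (EuclideanSpace ℝ (Fin m) × ℝ) → Prop}
    (hae : ∀ᵐ q ∂(volume : Measure (EuclideanSpace ℝ (Fin m) × ℝ)), P q) :
    ∀ᵐ p ∂g₀.riemVolume.prod (volume : Measure ℝ),
      p.1 ∈ (extChartAt I x).source → P (extChartAt I x p.1, p.2) := by
  -- adapted from `Literature.Geometry.Riemannian.ae_prod_chart_of_ae_volume`
  classical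
  rw [riemVolume_eq hR₀]
  set G₀ := g₀.toContMDiffRiemannianMetric hR₀ with hG₀
  obtain ⟨N, hNsub, hNm, hN0⟩ := exists_measurable_superset_of_null
    (show (volume : Measure (EuclideanSpace ℝ (Fin m) × ℝ)) {q | ¬P q} = 0 from hae)
  have hvol : (volume : Measure (EuclideanSpace ℝ (Fin m) × ℝ)) =
      (volume : Measure (EuclideanSpace ℝ (Fin m))).prod (volume : Measure ℝ) := rfl
  rw [hvol] at hN0
  have h1 : ∀ᵐ y ∂(volume : Measure (EuclideanSpace ℝ (Fin m))),
      (volume : Measure ℝ) (Prod.mk y ⁻¹' N) = 0 := measure_ae_null_of_prod_null hN0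
  have h2 := ae_source_of_ae_target_nc G₀ x h1
  set S : Set (M × ℝ) := {p | p.1 ∈ (extChartAt I x).source ∧ (extChartAt I x p.1, p.2) ∈ N}
    with hS
  have hsrc : MeasurableSet (extChartAt I x).source := (isOpen_extChartAt_source x).measurableSet
  have hSm : MeasurableSet S := by
    have hm : Measurable (((extChartAt I x).source ×ˢ (univ : Set ℝ)).piecewise
        (fun p : M × ℝ ↦ ((extChartAt I x p.1, p.2) : (EuclideanSpace ℝ (Fin m) × ℝ))) fun _ ↦ (extChartAt I x x, 0)) := by
      refine ContinuousOn.measurable_piecewise ?_ continuousOn_const (hsrc.prod MeasurableSet.univ)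
      exact ((continuousOn_extChartAt x).comp continuous_fst.continuousOn
        (fun p hp ↦ hp.1)).prodMk continuous_snd.continuousOn
    have hS' : S = ((extChartAt I x).source ×ˢ (univ : Set ℝ)) ∩
        (((extChartAt I x).source ×ˢ (univ : Set ℝ)).piecewise
          (fun p : M × ℝ ↦ ((extChartAt I x p.1, p.2) : (EuclideanSpace ℝ (Fin m) × ℝ))) fun _ ↦ (extChartAt I x x, 0)) ⁻¹' N := by
      ext p
      simp only [hS, mem_setOf_eq, mem_inter_iff, mem_prod, mem_univ, and_true, Set.mem_preimage]
      constructor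
      · rintro ⟨hp, hpN⟩
        refine ⟨hp, ?_⟩
        rwa [piecewise_eq_of_mem _ _ _ (show p ∈ (extChartAt I x).source ×ˢ (univ : Set ℝ) from
          ⟨hp, mem_univ _⟩)]
      · rintro ⟨hp, hpN⟩
        refine ⟨hp, ?_⟩
        rwa [piecewise_eq_of_mem _ _ _ (show p ∈ (extChartAt I x).source ×ˢ (univ : Set ℝ) from
          ⟨hp, mem_univ _⟩)] at hpN
    rw [hS']
    exact (hsrc.prod MeasurableSet.univ).inter (hm hNm)
  have hS0 : ((riemannianMeasure G₀).prod (volume : Measure ℝ)) S = 0 := by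
    refine measure_prod_null_of_ae_null hSm ?_
    filter_upwards [h2] with p hp
    by_cases hps : p ∈ (extChartAt I x).source
    · have : Prod.mk p ⁻¹' S = Prod.mk (extChartAt I x p) ⁻¹' N := by
        ext t
        simp only [hS, Set.mem_preimage, mem_setOf_eq]
        exact ⟨fun h ↦ h.2, fun h ↦ ⟨hps, h⟩⟩
      rw [this]
      exact hp hps
    · have : Prod.mk p ⁻¹' S = ∅ := by
        ext t
        simp only [hS, Set.mem_preimage, mem_setOf_eq, mem_empty_iff_false, iff_false, not_and]
        exact fun h _ ↦ hps h
      rw [this, measure_empty, Pi.zero_apply]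
  rw [← compl_mem_ae_iff] at hS0
  filter_upwards [hS0] with p hp hps
  by_contra hP
  exact hp ⟨hps, hNsub hP⟩

/-- **Local integrability transfers to the space-time chart** (non-compact `M`): if `u` is
locally integrable on `M × T` (`T` open) for `dV_{g₀} ⊗ ds` (`g₀` Riemannian), then `(y, s) ↦ u(φ⁻¹ y, s)` is locally
integrable on `φ.target × T` for Lebesgue measure (the chart density is bounded below on compact
parts of the target; Tonelli on the manifold side uses σ-finiteness of `dV_{g₀}`, which holds
since it is finite on compact sets and `M` is locally compact and second countable).
[cite: Chavel2006, §III.3 (III.3.6)] -/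
theorem locallyIntegrableOn_comp_chart_prod_nc [I.Boundaryless] [SecondCountableTopology M]
    (hR₀ : g₀.IsRiemannian) (x : M)
    {T : Set ℝ} (hT : IsOpen T) {u : M × ℝ → ℝ} (hum : Measurable u)
    (hu : LocallyIntegrableOn u (univ ×ˢ T) (g₀.riemVolume.prod (volume : Measure ℝ))) :
    LocallyIntegrableOn (fun q : (EuclideanSpace ℝ (Fin m) × ℝ) ↦ u ((extChartAt I x).symm q.1, q.2))
      ((extChartAt I x).target ×ˢ T) (volume : Measure (EuclideanSpace ℝ (Fin m) × ℝ)) := by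
  -- adapted from `Literature.Geometry.Riemannian.locallyIntegrableOn_comp_chart_prod`
  rw [riemVolume_eq hR₀] at hu
  set G₀ := g₀.toContMDiffRiemannianMetric hR₀ with hG₀
  set φ := extChartAt I x with hφ
  have hTo : IsOpen (φ.target ×ˢ T) := (isOpen_extChartAt_target x).prod hT
  have hΨ : ContinuousOn (fun q : (EuclideanSpace ℝ (Fin m) × ℝ) ↦ ((φ.symm q.1, q.2) : M × ℝ)) (φ.target ×ˢ (Set.univ : Set ℝ)) :=
    ((continuousOn_extChartAt_symm x).comp continuous_fst.continuousOn
      (fun q hq ↦ hq.1)).prodMk continuous_snd.continuousOn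
  rw [locallyIntegrableOn_iff hTo.isLocallyClosed]
  intro K hKsub hK
  have hmeas : AEStronglyMeasurable (fun q : (EuclideanSpace ℝ (Fin m) × ℝ) ↦ u (φ.symm q.1, q.2))
      ((volume : Measure (EuclideanSpace ℝ (Fin m) × ℝ)).restrict K) := by
    have h1 : AEMeasurable (fun q : (EuclideanSpace ℝ (Fin m) × ℝ) ↦ ((φ.symm q.1, q.2) : M × ℝ))
        ((volume : Measure (EuclideanSpace ℝ (Fin m) × ℝ)).restrict K) :=
      (hΨ.mono (hKsub.trans (prod_mono le_rfl (subset_univ _)))).aemeasurable hK.measurableSet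
    exact (hum.comp_aemeasurable h1).aestronglyMeasurable
  refine ⟨hmeas, ?_⟩
  set K₁ : Set (EuclideanSpace ℝ (Fin m)) := Prod.fst '' K with hK₁
  have hK₁c : IsCompact K₁ := hK.image continuous_fst
  have hK₁T : K₁ ⊆ φ.target := by
    rintro _ ⟨q, hq, rfl⟩; exact (hKsub hq).1
  have hρc : ContinuousOn (fun y ↦ Real.sqrt (chartGramMatrix G₀ x y).det) φ.target :=
    (contDiffOn_sqrt_det_chartGramMatrix' G₀ x).continuousOn
  obtain ⟨lam, hlam, hlamle⟩ : ∃ lam : ℝ, 0 < lam ∧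
      ∀ y ∈ K₁, lam ≤ Real.sqrt (chartGramMatrix G₀ x y).det := by
    rcases K₁.eq_empty_or_nonempty with hKe | hKne
    · exact ⟨1, one_pos, fun y hy ↦ by rw [hKe] at hy; exact hy.elim⟩
    · obtain ⟨y₀, hy₀, hmin⟩ := hK₁c.exists_isMinOn hKne (hρc.mono hK₁T)
      exact ⟨_, sqrt_det_chartGramMatrix_pos G₀ x (hK₁T hy₀), fun y hy ↦ hmin hy⟩
  set K' : Set (M × ℝ) := (fun q : (EuclideanSpace ℝ (Fin m) × ℝ) ↦ ((φ.symm q.1, q.2) : M × ℝ)) '' K with hK'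
  have hK'c : IsCompact K' :=
    hK.image_of_continuousOn (hΨ.mono (hKsub.trans (prod_mono le_rfl (subset_univ _))))
  have hK'T : K' ⊆ (Set.univ : Set M) ×ˢ T := by
    rintro _ ⟨q, hq, rfl⟩; exact ⟨mem_univ _, (hKsub hq).2⟩
  have hfin : ∫⁻ p in K', ‖u p‖ₑ ∂(riemannianMeasure G₀).prod (volume : Measure ℝ) < ⊤ :=
    (hu.integrableOn_compact_subset hK'T hK'c).2
  have hKm : MeasurableSet K := hK.measurableSet
  have hK'm : MeasurableSet K' := hK'c.measurableSet
  -- σ-finiteness of the Riemannian measure (finite on compacts, locally compact, 2nd countable)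
  haveI : LocallyCompactSpace M := Manifold.locallyCompact_of_finiteDimensional (M := M) I
  haveI : IsFiniteMeasureOnCompacts (riemannianMeasure G₀) :=
    ⟨fun K hK ↦ riemannianVolume_lt_top_of_isCompact_holds G₀ le_rfl hK⟩
  have hslice : ∀ s : ℝ, ∫⁻ y, K.indicator (fun q : (EuclideanSpace ℝ (Fin m) × ℝ) ↦ ‖u (φ.symm q.1, q.2)‖ₑ) (y, s) ≤
      ENNReal.ofReal (1 / lam) *
        ∫⁻ p, K'.indicator (fun p : M × ℝ ↦ ‖u p‖ₑ) (p, s) ∂riemannianMeasure G₀ := by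
    intro s
    set F : M → ℝ≥0∞ := fun p ↦ K'.indicator (fun p : M × ℝ ↦ ‖u p‖ₑ) (p, s) with hF
    have hFm : Measurable F :=
      (hum.enorm.indicator hK'm).comp (measurable_id.prodMk measurable_const)
    have hFsupp : support F ⊆ φ.source := by
      intro p hp
      rw [mem_support, hF] at hp
      have hpK : (p, s) ∈ K' := by
        by_contra h'; exact hp (indicator_of_notMem h' _)
      obtain ⟨q, hq, hpq⟩ := hpK
      have : p = φ.symm q.1 := (congrArg Prod.fst hpq).symm
      rw [this]
      exact φ.map_target (hKsub hq).1
    have key : ∀ y, K.indicator (fun q : (EuclideanSpace ℝ (Fin m) × ℝ) ↦ ‖u (φ.symm q.1, q.2)‖ₑ) (y, s) ≤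
        ENNReal.ofReal (1 / lam) * (φ.target).indicator
          (fun y ↦ F (φ.symm y) * ENNReal.ofReal (Real.sqrt (chartGramMatrix G₀ x y).det)) y := by
      intro y
      by_cases hyK : (y, s) ∈ K
      · have hyT : y ∈ φ.target := (hKsub hyK).1
        have hyK₁ : y ∈ K₁ := ⟨(y, s), hyK, rfl⟩
        have hyK' : ((φ.symm y, s) : M × ℝ) ∈ K' := ⟨(y, s), hyK, rfl⟩
        rw [indicator_of_mem hyK, indicator_of_mem hyT, hF]
        dsimp only
        rw [indicator_of_mem hyK']
        have hρ := hlamle y hyK₁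
        calc ‖u (φ.symm y, s)‖ₑ
            = ENNReal.ofReal (1 / lam) * ENNReal.ofReal lam * ‖u (φ.symm y, s)‖ₑ := by
              rw [← ENNReal.ofReal_mul (by positivity), one_div_mul_cancel hlam.ne',
                ENNReal.ofReal_one, one_mul]
          _ = ENNReal.ofReal (1 / lam) * (‖u (φ.symm y, s)‖ₑ * ENNReal.ofReal lam) := by ring
          _ ≤ ENNReal.ofReal (1 / lam) * (‖u (φ.symm y, s)‖ₑ *
              ENNReal.ofReal (Real.sqrt (chartGramMatrix G₀ x y).det)) :=
              mul_le_mul_right (mul_le_mul_right (ENNReal.ofReal_le_ofReal hρ) _) _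
      · rw [indicator_of_notMem hyK]
        exact zero_le
    calc ∫⁻ y, K.indicator (fun q : (EuclideanSpace ℝ (Fin m) × ℝ) ↦ ‖u (φ.symm q.1, q.2)‖ₑ) (y, s)
        ≤ ∫⁻ y, ENNReal.ofReal (1 / lam) * (φ.target).indicator
            (fun y ↦ F (φ.symm y) * ENNReal.ofReal (Real.sqrt (chartGramMatrix G₀ x y).det)) y :=
          lintegral_mono key
      _ = ENNReal.ofReal (1 / lam) * ∫⁻ y in φ.target,
            F (φ.symm y) * ENNReal.ofReal (Real.sqrt (chartGramMatrix G₀ x y).det) := by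
          rw [lintegral_const_mul' _ _ ENNReal.ofReal_ne_top,
            lintegral_indicator (measurableSet_extChartAt_target x)]
      _ = ENNReal.ofReal (1 / lam) * ∫⁻ p, F p ∂riemannianMeasure G₀ := by
          rw [← lintegral_eq_lintegral_chart G₀ x hFm hFsupp]
  have hAE : AEMeasurable (K.indicator fun q : (EuclideanSpace ℝ (Fin m) × ℝ) ↦ ‖u (φ.symm q.1, q.2)‖ₑ) (volume : Measure (EuclideanSpace ℝ (Fin m) × ℝ)) :=
    (aemeasurable_indicator_iff hKm).2 hmeas.aemeasurable.enorm
  calc ∫⁻ q in K, ‖u (φ.symm q.1, q.2)‖ₑ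
      = ∫⁻ q, K.indicator (fun q : (EuclideanSpace ℝ (Fin m) × ℝ) ↦ ‖u (φ.symm q.1, q.2)‖ₑ) q := (lintegral_indicator hKm _).symm
    _ = ∫⁻ s, ∫⁻ y, K.indicator (fun q : (EuclideanSpace ℝ (Fin m) × ℝ) ↦ ‖u (φ.symm q.1, q.2)‖ₑ) (y, s) := by
        rw [show (volume : Measure (EuclideanSpace ℝ (Fin m) × ℝ)) =
          (volume : Measure (EuclideanSpace ℝ (Fin m))).prod (volume : Measure ℝ) from rfl] at hAE ⊢
        exact lintegral_prod_symm _ hAE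
    _ ≤ ∫⁻ s, ENNReal.ofReal (1 / lam) *
          ∫⁻ p, K'.indicator (fun p : M × ℝ ↦ ‖u p‖ₑ) (p, s) ∂riemannianMeasure G₀ :=
        lintegral_mono hslice
    _ = ENNReal.ofReal (1 / lam) *
          ∫⁻ p, K'.indicator (fun p : M × ℝ ↦ ‖u p‖ₑ) p ∂(riemannianMeasure G₀).prod volume := by
        rw [lintegral_const_mul' _ _ ENNReal.ofReal_ne_top, lintegral_prod_symm]
        exact ((hum.enorm.indicator hK'm).aemeasurable :)
    _ = ENNReal.ofReal (1 / lam) * ∫⁻ p in K', ‖u p‖ₑ ∂(riemannianMeasure G₀).prod volume := by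
        rw [lintegral_indicator hK'm]
    _ < ⊤ := ENNReal.mul_lt_top ENNReal.ofReal_lt_top hfin

/-- **Registered helper `helper_locallyIntegrableOn_chart_noncompact`** (line `collapsed-ends-usc`):
`locallyIntegrableOn_comp_chart_prod_nc` with all arguments explicit — on a `T3`, second-countable
manifold modelled on `ℝᵐ` with a Riemannian metric `g₀`, local integrability of `u` on `M × T`
for `dV_{g₀} ⊗ ds` passes to the space-time chart representative `u ∘ (φ⁻¹ × id)` on
`φ.target × T` (Lebesgue). [cite: Chavel2006, §III.3 (III.3.6)] -/
theorem helper_locallyIntegrableOn_chart_noncompact : ∀ (m : ℕ) (H : Type*) [TopologicalSpace H] (I : ModelWithCorners ℝ (EuclideanSpace ℝ (Fin m)) H) [I.Boundaryless] (M : Type*) [TopologicalSpace M] [ChartedSpace H M] [IsManifold I ∞ M] [T3Space M] [SecondCountableTopology M] [MeasurableSpace M] [BorelSpace M] (g₀ : PseudoRiemannianMetric I ∞ (EuclideanSpace ℝ (Fin m)) (TangentSpace I : M → Type _)), g₀.IsRiemannian → ∀ (x : M) (T : Set ℝ) (u : M × ℝ → ℝ), IsOpen T → Measurable u → LocallyIntegrableOn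 u (univ ×ˢ T) (g₀.riemVolume.prod (volume : Measure ℝ)) → LocallyIntegrableOn (fun q : EuclideanSpace ℝ (Fin m) × ℝ ↦ u ((extChartAt I x).symm q.1, q.2)) ((extChartAt I x).target ×ˢ T) (volume : Measure (EuclideanSpace ℝ (Fin m) × ℝ)) := by
  intro m H _ I _ M _ _ _ _ _ _ _ g₀ hR₀ x T u hT hum hu
  exact locallyIntegrableOn_comp_chart_prod_nc hR₀ x hT hum hu

end Summit.SmoothPoincare4.SmoothPoincare4.Theorems.NoncompactShrinkerGapHeat

end
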